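import Summits.Ventures.QEC.CircuitDistance.PortK2DataBB144X
import Summits.Ventures.QEC.CircuitDistance.K2Chunks
import HarnessLib

/-!
# K2(`[[144,12,12]]`) chunk module — COMPUTATIONAL (native_decide; `Lean.ofReduceBool`)

Cell `qec`, CDX, R146/R152 STEP 1 («computational» header; `ofReduceBool` confined to these chunk modules). Checker of record
`K2.K2Data` (qec-cdx-type-1, PortK2Check); data module of record `PortK2DataBB144X/Z` (p669158/9, crit-1 data audit PASS
2026-08-28T21:20Z); chunk glue `K2Chunks` (idea-1 g2). Cube 1, child 10: leaf group 2 of 3.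
Leaf theorems: the K2 DFS accepts below one descendant state of pivot cube 1 (sector X); sizes are exact DFS visit counts
(eng-1 g2 `k2count.c`), capped so that the gate's native-axiom audit re-verifies every leaf in place. Assemblies re-derive the
child lists in the kernel (`decide`) and end in the literal cube fact `d144X.cube (Ts144X.getD 1 []) (72) (lives144X.getD 1 0) = true`
(the `hcubes` hypothesis of `K2Inst.k2_complete`). Emitted by qec-cdx-eng-1 g2 (`gen2.py`, idea-1's `gen_k2chunks_from_lean.py` lineage).
-/

namespace Summit.Ventures.QEC.CircuitDistance.K2

set_option maxRecDepth 100000 in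
set_option maxHeartbeats 0 in
set_option exponentiation.threshold 1024 in
/-- K2(144) chunk fact `cube144X1_ch10_5` (268866 DFS visits; see the module docstring). -/
theorem cube144X1_ch10_5 : app5 (d144X.dfs (Ts144X.getD 1 []) 6) (463762675228104595456, 2021, 121416805764108066932479224680824003587354763137497449379058457954998263037653155840, 3, 2348542582773833227889480475313245713578108828388529380896413248020169827473920951283758890026005752327438336) = true := by native_decide

set_option maxRecDepth 100000 in
set_option maxHeartbeats 0 in
set_option exponentiation.threshold 1024 in
/-- K2(144) chunk fact `cube144X1_ch10_6` (659366 DFS visits; see the module docstring). -/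
theorem cube144X1_ch10_6 : app5 (d144X.dfs (Ts144X.getD 1 []) 6) (55340232221128655360, 0, 121416805764108066932492080185178075509559098834236178679878635578948525380335566848, 3, 2348542582773833227889480475313245713578108828362818372188269403611498433996462349643403642125481066962616320) = true := by native_decide

set_option maxRecDepth 100000 in
set_option maxHeartbeats 0 in
set_option exponentiation.threshold 1024 in
/-- K2(144) chunk fact `cube144X1_ch10_7` (455485 DFS visits; see the module docstring). -/
theorem cube144X1_ch10_7 : app5 (d144X.dfs (Ts144X.getD 1 []) 6) (2674777890687901798656, 3040, 121416805764108066934111873733791137707305396623316070583221016196681580558319353856, 3, 2348542582773833227889480475313245713578108826717313814867063361456529251439111844660667776491901203614007296) = true := by native_decide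

set_option maxRecDepth 100000 in
set_option maxHeartbeats 0 in
set_option exponentiation.threshold 1024 in
/-- K2(144) chunk fact `cube144X1_ch10_8` (339849 DFS visits; see the module docstring). -/
theorem cube144X1_ch10_8 : app5 (d144X.dfs (Ts144X.getD 1 []) 6) (313594649253331210304, 2031, 121416805764108068617463035873384918831838870379485637180559806739833780763946385408, 3, 2348542582773833227889480475313245713578107141720647117952076194768086312712194742339141367706121134638366720) = true := by native_decide

set_option maxRecDepth 100000 in
set_option maxHeartbeats 0 in
set_option exponentiation.threshold 1024 in
/-- K2(144) chunk fact `cube144X1_ch10_9` (221829 DFS visits; see the module docstring). -/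
theorem cube144X1_ch10_9 : app5 (d144X.dfs (Ts144X.getD 1 []) 6) (323106533141045841920, 2272, 121535376863487078716580105865118828082792175905056336015814684897072103739722039296, 3, 2348542582773833227889480475194674614199095357606910429303179777126337848414578804762736801682018089887072256) = true := by native_decide
end Summit.Ventures.QEC.CircuitDistance.K2
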